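import Literature.NumberTheory.Automorphic.SmoothIndCellFunTorusTransport     -- ★ T1 `SmoothInd.cellFun_smoothIndRep_of_conj_of_smul`, `SmoothInd.continuous_cellFun`
import HarnessLib

/-!
# F0 · P3c · line LH6 «StCharTS» — «CELL-FUNCTION ANNULUS FORMULA★» (ROAD «KEYS3-ANALYTIC», LEAD T15-03; brick B5 of MEMO v3 §1, generic): for `m` normalising the cell
# (`ι(γ) m = m ι(c γ)`, `μ ∘ c⁻¹ = κ μ`, `σ(w₀ m w₀⁻¹) = s`) and scalars with `a·s·κ = b`, the Haar functional of the compactly supported cell function of `a·(m·f) − b·f` is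
# `b · (∫_{c(K)} F − ∫_K F)`, `F` the cell function of `f`, for every compact `K` containing the support — «`Λ(g₀(m)) = χ(m)·(annulus integral)`»
# [BernsteinZelevinsky1977 §5 (5.2); Casselman1995 §6.3; Keys1984 §7]

Cell `pub/hodgecm-mathlib`, crux H413 = `stmt-HodgeConjecture-24833` (lane `--supports … --as helper`), route HCCMUnconditional; seat F0P2-p06 (g21), ROAD «KEYS3-ANALYTIC» (LEAD
F0P3a-plan (g16) T15-03 «GO»; MEMO `F0/P2/F0P2-p06/g21/MEMO-KEYS3-analytic-road.v3` §1 «ANNULUS FORMULA»).  THEOREMS ONLY (0 def ∕ 0 instance ∕ 0 notation ∕ 0 sorry); frame = ★ T1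
`SmoothIndCellFunTorusTransport` (`H ≤ G`, `σ` on a Banach space `W`, `ι : Γ →* G`, `w₀ ∈ G`, cell function `γ ↦ f(w₀ ι(γ))`, a measure `μ` on `Γ`).  Nothing here is specific to `U(3)`.
* §1 `setIntegral_comp_eq_smul_setIntegral_image` — `∫_K g(c γ) dμ = κ • ∫_{c(K)} g dμ` for a measurable embedding `c` with `μ.map c = κ • μ` (Mathlib `MeasurableEmbedding.integral_map`).
* §2 `cellFun_sub_smul` (the cell function of `a • (m·f) − b • f` is `a s · F∘c − b · F`) and **`integral_cellFun_sub_eq_smul_sub_setIntegral`** — THE ANNULUS FORMULA: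
  `∫ (a•(m·f) − b•f)(w₀ ι γ) dμ = b • (∫_{c(K)} F − ∫_K F)` whenever `a s κ = b`, `K` compact ⊇ the support, `c` continuous, `μ` finite on compacts.
USE (B6): `Γ = N(L⁺_v)`, `m ∈ T`, `c = Ad(m⁻¹)`, `κ = δ_B(m)` (★ T2 `CMBorelTorusConjHaar`), `s = (χδ^{1/2})(ʷm) = wχ(m)‖α‖⁻¹` (★ T3b), `a = δ_B^{-1/2}(m)`, `b = χ(m)`; `a s κ = wχ(m) = χ(m)` at a
`w`-FIXED `χ` — so `Λ(g₀(m)) = χ(m)·(∫_{c(K_A)} − ∫_{K_A}) F = ±χ(m)·(annulus integral)`, which ★ B3 + B4 evaluate to `0`.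
HONEST LABEL: HC_CM is proved only modulo the 7 printed citations (2 remaining named inputs: hLiu418 = `stmt-HodgeConjecture-24832`, h413 = `stmt-HodgeConjecture-24833`) until rung 0
closes; count-neutral generic brick.

## References
* [BernsteinZelevinsky1977] I. N. Bernstein, A. V. Zelevinsky, Ann. Sci. ÉNS 10 (1977), §5 (5.2), Geometrical Lemma 2.12.
* [Casselman1995] W. Casselman, *Introduction to the theory of admissible representations of p-adic reductive groups* (1995), §6.3, Lemma 7.1.1 (a).
* [Keys1984] D. Keys, Compositio Math. 51 (1984), §7 Thm. (1).
-/

set_option autoImplicit false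
-- the mandated namespace has the single-problem summit's repeated segment (`HodgeConjecture.HodgeConjecture`)
set_option linter.dupNamespace false

noncomputable section

open MeasureTheory Set
open scoped NNReal ENNReal
open Literature.NumberTheory.Automorphic

namespace Summit.HodgeConjecture.HodgeConjecture.Cruxes.H413.F0P3cStCharTSCellFunAnnulusFormula

/-! ## §1 Set integrals under a measure-scaling embedding -/

section SetIntegral

variable {Γ : Type*} [MeasurableSpace Γ] (μ : Measure Γ) {W : Type*} [NormedAddCommGroup W] [NormedSpace ℝ W]

/-- **`∫_K g(c γ) dμ = κ • ∫_{c(K)} g dμ`** for a measurable embedding `c` with `μ.map c = κ • μ` and a measurable `K` (no integrability hypothesis: both sides are junk together).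
[cite: Casselman1995, §6.3] -/
theorem setIntegral_comp_eq_smul_setIntegral_image (c : Γ → Γ) (hc : MeasurableEmbedding c) {κ : ℝ≥0} (hμ : μ.map c = κ • μ)
    (g : Γ → W) {K : Set Γ} (hK : MeasurableSet K) :
    ∫ γ in K, g (c γ) ∂μ = (κ : ℝ) • ∫ γ in c '' K, g γ ∂μ := by
  have hind : K.indicator (fun γ => g (c γ)) = fun γ => (c '' K).indicator g (c γ) := by
    funext γ
    rw [← Set.indicator_comp_right, hc.injective.preimage_image]
    rfl
  rw [← integral_indicator hK, hind, ← hc.integral_map, hμ, integral_smul_nnreal_measure, integral_indicator (hc.measurableSet_image.2 hK),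
    NNReal.smul_def]

end SetIntegral

/-! ## §2 The annulus formula for the cell function of `a • (m · f) − b • f` -/

section Annulus

variable {G : Type*} [Group G] [TopologicalSpace G] [IsTopologicalGroup G] (H : Subgroup G)
  {W : Type*} [NormedAddCommGroup W] [NormedSpace ℂ W] (σ : Representation ℂ H W)
  {Γ : Type*} [Group Γ] [TopologicalSpace Γ] [IsTopologicalGroup Γ] [T2Space Γ] [MeasurableSpace Γ] [BorelSpace Γ]
  (ι : Γ →* G) (w₀ : G) (μ : Measure Γ)

omit [TopologicalSpace Γ] [IsTopologicalGroup Γ] [T2Space Γ] [MeasurableSpace Γ] [BorelSpace Γ] in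
/-- **The cell function of `a • (m·f) − b • f` is `a s · F∘c − b · F`** (`F` the cell function of `f`; ★ T1). [cite: BernsteinZelevinsky1977, §5 (5.2)] -/
theorem cellFun_sub_smul (m : G) (hm : w₀ * m * w₀⁻¹ ∈ H) (c : Γ → Γ) (hc : ∀ γ, ι γ * m = m * ι (c γ))
    {s : ℂ} (hs : ∀ w, σ ⟨w₀ * m * w₀⁻¹, hm⟩ w = s • w) (f : Representation.SmoothInd H σ) (a b : ℂ) (γ : Γ) :
    (a • Representation.smoothIndRep H σ m f - b • f).toFun (w₀ * ι γ) = (a * s) • f.toFun (w₀ * ι (c γ)) - b • f.toFun (w₀ * ι γ) := by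
  rw [sub_eq_add_neg, Representation.SmoothInd.toFun_add, Representation.SmoothInd.toFun_smul, ← neg_one_smul ℂ (b • f),
    Representation.SmoothInd.toFun_smul, Representation.SmoothInd.toFun_smul, Pi.add_apply, Pi.smul_apply, Pi.smul_apply, Pi.smul_apply,
    SmoothInd.cellFun_smoothIndRep_of_conj ι w₀ m hm c hc f γ, hs, smul_smul, smul_smul, neg_one_mul, neg_smul, ← sub_eq_add_neg]

variable [IsFiniteMeasureOnCompacts μ]

/-- **«CELL-FUNCTION ANNULUS FORMULA».**  `m` normalises the cell (`w₀ m w₀⁻¹ ∈ H`, `ι(γ) m = m ι(c γ)`), `c` a continuous measurable embedding with `μ.map c = κ • μ`, `σ(w₀ m w₀⁻¹) = s`, and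
`a s κ = b`.  If the cell function of `a • (m·f) − b • f` is supported in a compact `K`, then
  `∫ (a•(m·f) − b•f)(w₀ ι γ) dμ(γ) = b • ( ∫_{c(K)} F dμ − ∫_K F dμ )`,  `F(γ) = f(w₀ ι γ)`.
(`= 0` when `c(K) = K`, e.g. for `m` in the compact part of a torus acting on norm balls; for `c(K_A) = K_{A/Q}` it is `∓ b ·` the integral over the annulus.) [cite: Casselman1995, §6.3]
[cite: BernsteinZelevinsky1977, §5 (5.2)] [cite: Keys1984, §7 Thm. (1)] -/
theorem integral_cellFun_sub_eq_smul_sub_setIntegral (hι : Continuous ι) (m : G) (hm : w₀ * m * w₀⁻¹ ∈ H) (c : Γ → Γ) (hcc : Continuous c)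
    (hce : MeasurableEmbedding c) (hc : ∀ γ, ι γ * m = m * ι (c γ)) {κ : ℝ≥0} (hμ : μ.map c = κ • μ) {s : ℂ} (hs : ∀ w, σ ⟨w₀ * m * w₀⁻¹, hm⟩ w = s • w)
    (f : Representation.SmoothInd H σ) {a b : ℂ} (hab : a * s * (κ : ℂ) = b) {K : Set Γ} (hK : IsCompact K)
    (hsupp : Function.support (fun γ => (a • Representation.smoothIndRep H σ m f - b • f).toFun (w₀ * ι γ)) ⊆ K) :
    ∫ γ, (a • Representation.smoothIndRep H σ m f - b • f).toFun (w₀ * ι γ) ∂μ =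
      b • (∫ γ in c '' K, f.toFun (w₀ * ι γ) ∂μ - ∫ γ in K, f.toFun (w₀ * ι γ) ∂μ) := by
  have hF : Continuous fun γ => f.toFun (w₀ * ι γ) := SmoothInd.continuous_cellFun H σ ι w₀ hι f
  have hFc : Continuous fun γ => f.toFun (w₀ * ι (c γ)) := hF.comp hcc
  have hKm : MeasurableSet K := hK.measurableSet
  have h1 : IntegrableOn (fun γ => f.toFun (w₀ * ι (c γ))) K μ := hFc.continuousOn.integrableOn_compact hK
  have h2 : IntegrableOn (fun γ => f.toFun (w₀ * ι γ)) K μ := hF.continuousOn.integrableOn_compact hK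
  calc ∫ γ, (a • Representation.smoothIndRep H σ m f - b • f).toFun (w₀ * ι γ) ∂μ
      = ∫ γ in K, (a • Representation.smoothIndRep H σ m f - b • f).toFun (w₀ * ι γ) ∂μ := (setIntegral_eq_integral_of_forall_compl_eq_zero fun γ hγ =>
          Function.notMem_support.1 fun h' => hγ (hsupp h')).symm
    _ = ∫ γ in K, ((a * s) • f.toFun (w₀ * ι (c γ)) - b • f.toFun (w₀ * ι γ)) ∂μ := by
          simp_rw [cellFun_sub_smul H σ ι w₀ m hm c hc hs f a b]
    _ = (a * s) • ∫ γ in K, f.toFun (w₀ * ι (c γ)) ∂μ - b • ∫ γ in K, f.toFun (w₀ * ι γ) ∂μ := by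
          have h1' : Integrable (fun γ => (a * s) • f.toFun (w₀ * ι (c γ))) (μ.restrict K) := h1.smul (a * s)
          have h2' : Integrable (fun γ => b • f.toFun (w₀ * ι γ)) (μ.restrict K) := h2.smul b
          rw [integral_sub h1' h2', integral_smul, integral_smul]
    _ = (a * s) • ((κ : ℝ) • ∫ γ in c '' K, f.toFun (w₀ * ι γ) ∂μ) - b • ∫ γ in K, f.toFun (w₀ * ι γ) ∂μ := by
          have h4 := setIntegral_comp_eq_smul_setIntegral_image μ c hce hμ (fun γ => f.toFun (w₀ * ι γ)) hKm
          beta_reduce at h4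
          rw [h4]
    _ = b • (∫ γ in c '' K, f.toFun (w₀ * ι γ) ∂μ - ∫ γ in K, f.toFun (w₀ * ι γ) ∂μ) := by
          rw [← Complex.coe_smul, smul_smul, hab, smul_sub]

end Annulus

end Summit.HodgeConjecture.HodgeConjecture.Cruxes.H413.F0P3cStCharTSCellFunAnnulusFormula

end
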